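import Mathlib

/-!
# Two-sided residual enclosure of a block of the inverse, and the Cholesky route to `λ_min ≥ 0`
(instab4 g0 — implementation 2 of the skew-cut X0 certifier, cell `ns-blowup`, 2026-08-26)

HONEST FRAMING (human ruling D-0035): nothing here is a claim about Navier–Stokes blow-up.
WHAT THIS IS NOT: not NS evidence. Companion of `SkewCutAPosteriori.lean` (selfsim g4: (V1)–(V4)) —
the two further finite-dimensional facts on which the float64 certifier `instab4/code/cert.py`
(method note `instab4/METHOD-I4.md`) rests when it verifies the hypotheses of
`selfsim/SKEWCUT-CERT.md` Theorems 1′/2 for the MODEL operator «NS linearised about the forced ABC flow»: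

* (V2′) TWO-SIDED (PRIMAL–DUAL) RESIDUAL IDENTITY — `block_inv_two_sided`: for a nonsingular `A`, ANY
  proposed right solutions `Y ≈ A⁻¹ F` and left solutions `Z ≈ G A⁻¹`,
  `G A⁻¹ F = Z F + (G − Z A) Y + (G − Z A) A⁻¹ (F − A Y)`.
  The last term is a product of the two residuals, so a crude bound on `‖A⁻¹‖` suffices to enclose
  the block `G A⁻¹ F` (in the certifier: the shell-`K` + border block `N_b` of the bordered inverse).
* (V5′) FACTORISATION WITH RESIDUAL ⇒ LOWER BOUND OF THE QUADRATIC FORM —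
  `quadForm_ge_neg_of_factor`: if `L * Lᵀ = S + Δ` then `v ⬝ (S v) ≥ -(v ⬝ (Δ v))` for every `v`
  (the algebraic half of «float Cholesky runs to completion ⇒ `λ_min(S) ≥ −‖ΔS‖`», Higham 2002
  Thm 10.3 supplying the bound on `Δ`), and `quadForm_congr_diag`: the diagonal congruence that moves
  the certificate between the exact-rational basis and the orthonormal one.

Mathlib only; no new definitions.
-/

namespace Summit.NavierStokesRegularity.FluidComputer.TwoSidedResidualEnclosure

open Matrix

section TwoSided

variable {n p q : Type*} [Fintype n] [DecidableEq n]
variable {R : Type*} [CommRing R]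

/-- **(V2′) two-sided residual identity.** For a nonsingular square matrix `A` and arbitrary
`F : n × p`, `G : q × n`, `Y : n × p`, `Z : q × n`:
`G A⁻¹ F = Z F + (G − Z A) Y + (G − Z A) A⁻¹ (F − A Y)`.  With `Y ≈ A⁻¹F`, `Z ≈ GA⁻¹` the last term is
second order in the residuals. -/
theorem block_inv_two_sided (A : Matrix n n R) (hA : IsUnit A.det)
    (F Y : Matrix n p R) (G Z : Matrix q n R) :
    G * A⁻¹ * F = Z * F + (G - Z * A) * Y + (G - Z * A) * A⁻¹ * (F - A * Y) := by
  have h1 : A⁻¹ * A = 1 := Matrix.nonsing_inv_mul A hA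
  have key : (G - Z * A) * A⁻¹ * (F - A * Y) = G * A⁻¹ * F - Z * F - (G - Z * A) * Y := by
    have e1 : (G - Z * A) * A⁻¹ * (A * Y) = (G - Z * A) * Y := by
      rw [Matrix.mul_assoc, ← Matrix.mul_assoc A⁻¹ A Y, h1, Matrix.one_mul]
    have e2 : Z * A * A⁻¹ * F = Z * F := by
      rw [Matrix.mul_assoc Z A A⁻¹, Matrix.mul_nonsing_inv A hA, Matrix.mul_one]
    rw [Matrix.mul_sub, e1, Matrix.sub_mul, Matrix.sub_mul, e2]
  rw [key]; abel

/-- Entrywise consequence used for the corner `ω` and the block `N_K`: the `(i, j)` entry of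
`G A⁻¹ F` differs from the computable quantity `(Z F + (G − Z A) Y) i j` exactly by the `(i, j)` entry of
the residual product `(G − Z A) A⁻¹ (F − A Y)`. -/
theorem block_inv_two_sided_apply (A : Matrix n n R) (hA : IsUnit A.det)
    (F Y : Matrix n p R) (G Z : Matrix q n R) (i : q) (j : p) :
    (G * A⁻¹ * F) i j - (Z * F + (G - Z * A) * Y) i j = ((G - Z * A) * A⁻¹ * (F - A * Y)) i j := by
  rw [block_inv_two_sided A hA F Y G Z]
  simp [Matrix.add_apply]

end TwoSided

section Cholesky

variable {n : Type*} [Fintype n]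

/-- **(V5′) factorisation with residual ⇒ lower bound of the quadratic form.** If `L Lᵀ = S + Δ`
(e.g. `L` the float Cholesky factor of `S`, `Δ` its backward error), then for every vector `v`,
`v ⬝ (S v) = ‖Lᵀ v‖² − v ⬝ (Δ v) ≥ −v ⬝ (Δ v)`. -/
theorem quadForm_ge_neg_of_factor (S Δ L : Matrix n n ℝ) (h : L * Lᵀ = S + Δ) (v : n → ℝ) :
    -(v ⬝ᵥ (Δ *ᵥ v)) ≤ v ⬝ᵥ (S *ᵥ v) := by
  have hS : S = L * Lᵀ - Δ := by rw [h]; abel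
  have hq : v ⬝ᵥ ((L * Lᵀ) *ᵥ v) = (Lᵀ *ᵥ v) ⬝ᵥ (Lᵀ *ᵥ v) := by
    rw [← Matrix.mulVec_mulVec, Matrix.dotProduct_mulVec, ← Matrix.mulVec_transpose]
  have hnn : 0 ≤ (Lᵀ *ᵥ v) ⬝ᵥ (Lᵀ *ᵥ v) := by
    unfold dotProduct
    exact Finset.sum_nonneg fun i _ => mul_self_nonneg _
  rw [hS, Matrix.sub_mulVec, dotProduct_sub, hq]
  linarith

/-- If moreover the residual form is bounded, `v ⬝ (Δ v) ≤ δ (v ⬝ v)`, then `S − (−δ)·1` is positive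
semidefinite as a quadratic form: `−δ (v ⬝ v) ≤ v ⬝ (S v)`. -/
theorem quadForm_ge_of_factor_of_bound (S Δ L : Matrix n n ℝ) (h : L * Lᵀ = S + Δ) (δ : ℝ)
    (hΔ : ∀ v : n → ℝ, v ⬝ᵥ (Δ *ᵥ v) ≤ δ * (v ⬝ᵥ v)) (v : n → ℝ) :
    -δ * (v ⬝ᵥ v) ≤ v ⬝ᵥ (S *ᵥ v) := by
  have := quadForm_ge_neg_of_factor S Δ L h v
  have := hΔ v
  linarith

/-- **Diagonal congruence** between the exact-rational basis and the orthonormal one: for a diagonal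
scaling `C = diagonal c`, `v ⬝ ((C T C) v) = (C v) ⬝ (T (C v))`; hence `T − μ C⁻²` positive
semidefinite transfers to `λ_min(C T C) ≥ μ` and back. -/
theorem quadForm_congr_diag [DecidableEq n] (T : Matrix n n ℝ) (c : n → ℝ) (v : n → ℝ) :
    v ⬝ᵥ ((Matrix.diagonal c * T * Matrix.diagonal c) *ᵥ v)
      = (Matrix.diagonal c *ᵥ v) ⬝ᵥ (T *ᵥ (Matrix.diagonal c *ᵥ v)) := by
  rw [← Matrix.mulVec_mulVec, ← Matrix.mulVec_mulVec, Matrix.dotProduct_mulVec]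
  congr 1
  funext i
  rw [Matrix.vecMul_diagonal, Matrix.mulVec_diagonal, mul_comm]

end Cholesky

/-! ### (V6′) The dominated Schur bound `‖M‖₂ ≤ √(‖X‖₁ ‖X‖_∞)` for rectangular `|M| ≤ X`
(instab4 g3, 2026-08-26)

`cert.py` never forms a 2-norm directly: every `‖·‖₂` it needs (the crude bound
`β₂ = √(β₁ β_∞) ≥ ‖A_b⁻¹‖₂` in the residual product of `block_inv_two_sided`, and the 2-norm of the
entrywise radius matrix in the Weyl step of the PSD test, `rigor.norm2_bound`) is obtained from the
maximal absolute ROW and COLUMN sums of a nonnegative matrix `X` dominating `|M|` entrywise. The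
square, undominated case is `Literature.Analysis.Matrix.SingularValueVerification.norm_toLp_mulVec_sq_le`
(Golub–Van Loan Cor. 2.3.2); here is the rectangular dominated form the certifier actually uses,
as an inequality between dot products (`(Mv)·(Mv) ≤ c r (v·v)`) and in Euclidean-norm form. -/

section SchurBound

open Finset WithLp

variable {m n : Type*} [Fintype m] [Fintype n]

/-- **(V6′) dominated Schur bound, quadratic form.** If `|M i j| ≤ X i j` for all `i, j`, every
column sum of `X` is `≤ c`, every row sum of `X` is `≤ r` and `0 ≤ r`, then for every `v`,
`(M v) ⬝ (M v) ≤ c · r · (v ⬝ v)`, i.e. `‖M v‖₂² ≤ ‖X‖₁ ‖X‖_∞ ‖v‖₂²`. (Weighted Cauchy–Schwarz per row: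
`(Σⱼ Xᵢⱼ|vⱼ|)² ≤ (Σⱼ Xᵢⱼ)(Σⱼ Xᵢⱼ vⱼ²)`, then exchange the sums.) The hypothesis `0 ≤ r` is only needed
when the row index type is empty. -/
theorem mulVec_dotProduct_mulVec_le_of_abs_le (M X : Matrix m n ℝ) (hMX : ∀ i j, |M i j| ≤ X i j)
    {c r : ℝ} (hc : ∀ j, ∑ i, X i j ≤ c) (hr : ∀ i, ∑ j, X i j ≤ r) (hr₀ : 0 ≤ r) (v : n → ℝ) :
    (M *ᵥ v) ⬝ᵥ (M *ᵥ v) ≤ c * r * (v ⬝ᵥ v) := by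
  have hX0 : ∀ i j, 0 ≤ X i j := fun i j => (abs_nonneg _).trans (hMX i j)
  -- per-row bound
  have hrow : ∀ i, (M *ᵥ v) i * (M *ᵥ v) i ≤ r * ∑ j, X i j * v j ^ 2 := fun i => by
    have h1 : |(M *ᵥ v) i| ≤ ∑ j, X i j * |v j| := by
      simp only [Matrix.mulVec, dotProduct]
      refine (abs_sum_le_sum_abs _ _).trans (sum_le_sum fun j _ => ?_)
      rw [abs_mul]
      exact mul_le_mul_of_nonneg_right (hMX i j) (abs_nonneg _)
    have h2 : (∑ j, X i j * |v j|) ^ 2 ≤ (∑ j, X i j) * ∑ j, X i j * v j ^ 2 :=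
      sum_sq_le_sum_mul_sum_of_sq_le_mul _ (fun j _ => hX0 i j)
        (fun j _ => mul_nonneg (hX0 i j) (sq_nonneg _))
        (fun j _ => le_of_eq (by rw [mul_pow, sq_abs (v j), sq]; ring))
    have h0 : 0 ≤ ∑ j, X i j * |v j| := sum_nonneg fun j _ => mul_nonneg (hX0 i j) (abs_nonneg _)
    calc (M *ᵥ v) i * (M *ᵥ v) i = |(M *ᵥ v) i| ^ 2 := by rw [sq_abs, sq]
      _ ≤ (∑ j, X i j * |v j|) ^ 2 := pow_le_pow_left₀ (abs_nonneg _) h1 2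
      _ ≤ (∑ j, X i j) * ∑ j, X i j * v j ^ 2 := h2
      _ ≤ r * ∑ j, X i j * v j ^ 2 :=
        mul_le_mul_of_nonneg_right (hr i) (sum_nonneg fun j _ => mul_nonneg (hX0 i j) (sq_nonneg _))
  have hvv : v ⬝ᵥ v = ∑ j, v j ^ 2 := by
    unfold dotProduct; exact sum_congr rfl fun j _ => (sq (v j)).symm
  rw [hvv]
  unfold dotProduct
  calc ∑ i, (M *ᵥ v) i * (M *ᵥ v) i ≤ ∑ i, r * ∑ j, X i j * v j ^ 2 := sum_le_sum fun i _ => hrow i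
    _ = r * ∑ j, (∑ i, X i j) * v j ^ 2 := by
      rw [← mul_sum, sum_comm]
      exact congrArg _ (sum_congr rfl fun j _ => (sum_mul _ _ _).symm)
    _ ≤ r * ∑ j, c * v j ^ 2 := mul_le_mul_of_nonneg_left
        (sum_le_sum fun j _ => mul_le_mul_of_nonneg_right (hc j) (sq_nonneg _)) hr₀
    _ = c * r * ∑ j, v j ^ 2 := by rw [← mul_sum]; ring

/-- **(V6′) dominated Schur bound, Euclidean-norm form.** Under the same hypotheses,
`‖M v‖₂ ≤ √(c r) ‖v‖₂` for every `v` (norms of `EuclideanSpace`, via `WithLp.toLp 2`): the operator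
`2`-norm of `M` is at most `√(‖X‖₁ ‖X‖_∞)`. Chained three times this is the entrywise bound
`|(Res_L · A_b⁻¹ · Res_R) i j| ≤ ‖Res_L‖₂ β₂ ‖Res_R‖₂` of the certifier's `N_b` enclosure. -/
theorem norm_toLp_mulVec_le_sqrt_of_abs_le (M X : Matrix m n ℝ) (hMX : ∀ i j, |M i j| ≤ X i j)
    {c r : ℝ} (hc : ∀ j, ∑ i, X i j ≤ c) (hr : ∀ i, ∑ j, X i j ≤ r) (hr₀ : 0 ≤ r) (v : n → ℝ) :
    ‖toLp 2 (M *ᵥ v)‖ ≤ √(c * r) * ‖toLp 2 v‖ := by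
  have hsq1 : ‖toLp 2 (M *ᵥ v)‖ ^ 2 = (M *ᵥ v) ⬝ᵥ (M *ᵥ v) := by
    rw [EuclideanSpace.real_norm_sq_eq]
    unfold dotProduct
    exact sum_congr rfl fun j _ => by simp [sq]
  have hsq2 : ‖toLp 2 v‖ ^ 2 = v ⬝ᵥ v := by
    rw [EuclideanSpace.real_norm_sq_eq]
    unfold dotProduct
    exact sum_congr rfl fun j _ => by simp [sq]
  have h := mulVec_dotProduct_mulVec_le_of_abs_le M X hMX hc hr hr₀ v
  rw [← hsq1, ← hsq2] at h
  calc ‖toLp 2 (M *ᵥ v)‖ = √(‖toLp 2 (M *ᵥ v)‖ ^ 2) := (Real.sqrt_sq (norm_nonneg _)).symm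
    _ ≤ √(c * r * ‖toLp 2 v‖ ^ 2) := Real.sqrt_le_sqrt h
    _ = √(c * r) * ‖toLp 2 v‖ := by
      rw [Real.sqrt_mul' _ (sq_nonneg _), Real.sqrt_sq (norm_nonneg _)]

end SchurBound

end Summit.NavierStokesRegularity.FluidComputer.TwoSidedResidualEnclosure
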